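import Literature.NumberTheory.IwasawaTheory.ImaginaryQuadraticTwoTowerDyadicLayers
import Literature.NumberTheory.IwasawaTheory.CyclicNormElementFixedPTorsion
import Literature.NumberTheory.IwasawaTheory.ImaginaryQuadraticTwoTowerGenusRankEven
import Literature.NumberTheory.IwasawaTheory.ClassicalMuVanishesReflectionLayer
import HarnessLib

/-!
# Ferrero's dyadic class is not a square: `[𝔓_m] ∉ Cl(K_m)²` for `m ≫ 0` in the cyclotomic `ℤ₂`-tower of `ℚ(√−d)`, `d ≡ 1 (mod 4)`

Topic `NumberTheory/IwasawaTheory`; namespace `Literature.NumberTheory.IwasawaTheory`.  Theorem-only file (no definition, no named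
fact, no `sorry`), unconditional.

`K ∋ √−d` of degree `2`, `d ≡ 1 (mod 4)` squarefree, `d ≠ 1`; `κ₀ = (ℚ_∞)|_K`, `K_m = κ₀.layer m`, `𝔓_m` the unique prime of `K_m` above `2`,
`c_m = [𝔓_m]` (order `2` for `m ≥ 2`).  This is the finite submodule `ℤ/2` of the Iwasawa module of `K` responsible for the `−1` in the
Ferrero–Kida formula `λ₂(K) = Σ_{ℓ ∣ d} 2^{ord₂(ℓ²−1)−3} − 1`: we prove that **`c_m` is not a square in `Cl(K_m)` for all large `m`**
(`exists_forall_mk0_dyadic_not_mem_range_pow_two`), the input of the upper bound `λ₂ ≤ Σ − 1`.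

## Proof

* §1 `dyadicKernel_layer_restrict` — for `b ≥ 1`, `k ≥ 1`: `ker(Cl(K_b) → Cl(K_{b+k})) ⊆ {1, c_b}` and `c_{b+k} ∉ im(Cl(K_b) → Cl(K_{b+k}))`, by
  induction on `k` from the one-step facts (tree `dyadicCapitulation_layer_restrict`) and `i_{K_{b+k+1}/K_b} = i_{K_{b+k+1}/K_{b+k}} ∘ i_{K_{b+k}/K_b}`.
* §2 `mk0_dyadic_not_mem_range_pow_two_layer_restrict` — `b ≥ 2`, `k ≥ 2`, `2·rank₂ Cl(K_{b+k}) ≤ 2^k − 1`: if `c_{b+k} = x²`, then `x⁴ = 1` and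
  `σ(x²) = x²` for the generator `σ` of `Gal(K_{b+k}/K_b)` (the dyadic prime is unique), so `i(N x) = ∏_τ τx = 1` (tree
  `classGroupExtend_classGroupNorm_eq_one_of_pow_sq_eq_one`: `ν = (σ−1)^{2^k−1} (mod 2)` and `σ − 1` is nilpotent on `Cl[2]`); by §1 `N x ∈ {1, c_b}`, but
  `(N x)² = N(c_{b+k}) = c_b ≠ 1` (tree `classGroupNorm_mk0_dyadic_layer_restrict`, `mk0_dyadic_ne_one_layer_restrict`) while `c_b² = 1` — contradiction.
* §3 `exists_forall_mk0_dyadic_not_mem_range_pow_two` — the `2`-ranks are bounded by `S = Σ_{ℓ ∣ d} 2^{ord₂(ℓ²−1)−3}` (tree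
  `classGroupPRank_cyclotomic_two_eq_sum_of_sq_eq_neg`); take `k = 2S + 2`.

## References

* B. Ferrero, *The cyclotomic ℤ₂-extension of imaginary quadratic fields*, Amer. J. Math. 102 (1980) 447–459, §3. [Ferrero1980AJM]
* Y. Kida, *On cyclotomic ℤ₂-extensions of imaginary quadratic fields*, Tohoku Math. J. 31 (1979) 91–96, Thm. 1. [Kida1979Tohoku]
* L. C. Washington, *Introduction to Cyclotomic Fields*, GTM 83, Springer 1997, §13.3. [Washington1997]
-/

noncomputable section

open NumberField IsDedekindDomain IntermediateField
open scoped nonZeroDivisors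

namespace Literature.NumberTheory.IwasawaTheory

open Literature.NumberTheory.EllipticCurves Literature.NumberTheory.EllipticCurves.ZpExtension
  Literature.NumberTheory.EllipticCurves.CoatesSujatha2005 Literature.NumberTheory.GaloisRepresentations
  Literature.NumberTheory.NumberFields

variable (K : Type) [Field K] [NumberField K]

/-! ## §1 The multi-step capitulation kernel -/

/-- The induction step of `dyadicKernel_layer_restrict`: from the pair `K_b ⊆ K_{b+k}` to `K_b ⊆ K_{b+k+1}` through `K_{b+k} ⊆ K_{b+k+1}`
(`i_{K_{b+k+1}/K_b} = i_{K_{b+k+1}/K_{b+k}} ∘ i_{K_{b+k}/K_b}`, tree `classGroupExtend_classGroupExtend`, and the one-step facts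
`dyadicCapitulation_layer_restrict` at `m = b + k`) (auxiliary). [cite: Ferrero1980AJM, §3] -/
private theorem dyadicKernel_step (hK2 : Module.finrank ℚ K = 2) {d : ℕ} (hsf : Squarefree d) (hd4 : d % 4 = 1) (hd1 : d ≠ 1)
    (hη : ∃ η : K, η ^ 2 = -((d : ℕ) : K))
    (h : Function.Surjective ((CyclotomicZp.zpExtension 2).toContinuousMonoidHom.comp (absGaloisRestrict ℚ K))) (b k : ℕ) (hbk : 1 ≤ b + k)
    [NumberField ↥(((CyclotomicZp.zpExtension 2).restrict K h).layer b)] [NumberField ↥(((CyclotomicZp.zpExtension 2).restrict K h).layer (b + k))] [NumberField ↥(((CyclotomicZp.zpExtension 2).restrict K h).layer (b + k + 1))]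
    (ih : (∀ 𝔓b : HeightOneSpectrum (𝓞 ↥(((CyclotomicZp.zpExtension 2).restrict K h).layer b)), (2 : 𝓞 ↥(((CyclotomicZp.zpExtension 2).restrict K h).layer b)) ∈ 𝔓b.asIdeal →
        ∀ c, @classGroupExtend ↥(((CyclotomicZp.zpExtension 2).restrict K h).layer b) ↥(((CyclotomicZp.zpExtension 2).restrict K h).layer (b + k)) _ _ _ _
            (IntermediateField.inclusion (((CyclotomicZp.zpExtension 2).restrict K h).layer_mono (Nat.le_add_right b k))).toRingHom.toAlgebra c = 1 →
          c = 1 ∨ c = ClassGroup.mk0 ⟨𝔓b.asIdeal, mem_nonZeroDivisors_of_ne_zero 𝔓b.ne_bot⟩) ∧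
      (∀ 𝔓 : HeightOneSpectrum (𝓞 ↥(((CyclotomicZp.zpExtension 2).restrict K h).layer (b + k))), (2 : 𝓞 ↥(((CyclotomicZp.zpExtension 2).restrict K h).layer (b + k))) ∈ 𝔓.asIdeal →
        ClassGroup.mk0 ⟨𝔓.asIdeal, mem_nonZeroDivisors_of_ne_zero 𝔓.ne_bot⟩ ∉
          (@classGroupExtend ↥(((CyclotomicZp.zpExtension 2).restrict K h).layer b) ↥(((CyclotomicZp.zpExtension 2).restrict K h).layer (b + k)) _ _ _ _
            (IntermediateField.inclusion (((CyclotomicZp.zpExtension 2).restrict K h).layer_mono (Nat.le_add_right b k))).toRingHom.toAlgebra).range)) :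
    (∀ 𝔓b : HeightOneSpectrum (𝓞 ↥(((CyclotomicZp.zpExtension 2).restrict K h).layer b)), (2 : 𝓞 ↥(((CyclotomicZp.zpExtension 2).restrict K h).layer b)) ∈ 𝔓b.asIdeal →
        ∀ c, @classGroupExtend ↥(((CyclotomicZp.zpExtension 2).restrict K h).layer b) ↥(((CyclotomicZp.zpExtension 2).restrict K h).layer (b + k + 1)) _ _ _ _
            (IntermediateField.inclusion (((CyclotomicZp.zpExtension 2).restrict K h).layer_mono (by omega))).toRingHom.toAlgebra c = 1 →
          c = 1 ∨ c = ClassGroup.mk0 ⟨𝔓b.asIdeal, mem_nonZeroDivisors_of_ne_zero 𝔓b.ne_bot⟩) ∧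
      (∀ 𝔓 : HeightOneSpectrum (𝓞 ↥(((CyclotomicZp.zpExtension 2).restrict K h).layer (b + k + 1))), (2 : 𝓞 ↥(((CyclotomicZp.zpExtension 2).restrict K h).layer (b + k + 1))) ∈ 𝔓.asIdeal →
        ClassGroup.mk0 ⟨𝔓.asIdeal, mem_nonZeroDivisors_of_ne_zero 𝔓.ne_bot⟩ ∉
          (@classGroupExtend ↥(((CyclotomicZp.zpExtension 2).restrict K h).layer b) ↥(((CyclotomicZp.zpExtension 2).restrict K h).layer (b + k + 1)) _ _ _ _
            (IntermediateField.inclusion (((CyclotomicZp.zpExtension 2).restrict K h).layer_mono (by omega))).toRingHom.toAlgebra).range) := by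
  classical
  letI A1 : Algebra ↥(((CyclotomicZp.zpExtension 2).restrict K h).layer b) ↥(((CyclotomicZp.zpExtension 2).restrict K h).layer (b + k)) :=
    (IntermediateField.inclusion (((CyclotomicZp.zpExtension 2).restrict K h).layer_mono (Nat.le_add_right b k))).toRingHom.toAlgebra
  letI A2 : Algebra ↥(((CyclotomicZp.zpExtension 2).restrict K h).layer (b + k)) ↥(((CyclotomicZp.zpExtension 2).restrict K h).layer (b + k + 1)) :=
    (IntermediateField.inclusion (((CyclotomicZp.zpExtension 2).restrict K h).layer_mono (Nat.le_succ (b + k)))).toRingHom.toAlgebra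
  letI A3 : Algebra ↥(((CyclotomicZp.zpExtension 2).restrict K h).layer b) ↥(((CyclotomicZp.zpExtension 2).restrict K h).layer (b + k + 1)) :=
    (IntermediateField.inclusion (((CyclotomicZp.zpExtension 2).restrict K h).layer_mono (by omega : b ≤ b + k + 1))).toRingHom.toAlgebra
  haveI : IsScalarTower ↥(((CyclotomicZp.zpExtension 2).restrict K h).layer b) ↥(((CyclotomicZp.zpExtension 2).restrict K h).layer (b + k)) ↥(((CyclotomicZp.zpExtension 2).restrict K h).layer (b + k + 1)) :=
    IsScalarTower.of_algebraMap_eq fun x =>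
      (IntermediateField.inclusion_inclusion
        ((((CyclotomicZp.zpExtension 2).restrict K h)).layer_mono (Nat.le_add_right b k))
        ((((CyclotomicZp.zpExtension 2).restrict K h)).layer_mono (Nat.le_succ (b + k))) x).symm
  obtain ⟨hker1, hnot1⟩ := dyadicCapitulation_layer_restrict K hK2 hsf hd4 hd1 hη h (b + k) hbk
  obtain ⟨hkerk, hnotk⟩ := ih
  obtain ⟨𝔓k, h2k, -, -⟩ := exists_unique_dyadic_layer_restrict K hK2 hd4 hη h (b + k)
  have hcomp : ∀ c : ClassGroup (𝓞 ↥(((CyclotomicZp.zpExtension 2).restrict K h).layer b)),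
      classGroupExtend ↥(((CyclotomicZp.zpExtension 2).restrict K h).layer (b + k)) ↥(((CyclotomicZp.zpExtension 2).restrict K h).layer (b + k + 1)) (classGroupExtend ↥(((CyclotomicZp.zpExtension 2).restrict K h).layer b) ↥(((CyclotomicZp.zpExtension 2).restrict K h).layer (b + k)) c) =
        classGroupExtend ↥(((CyclotomicZp.zpExtension 2).restrict K h).layer b) ↥(((CyclotomicZp.zpExtension 2).restrict K h).layer (b + k + 1)) c := fun c =>
    classGroupExtend_classGroupExtend (K := ↥(((CyclotomicZp.zpExtension 2).restrict K h).layer b)) ↥(((CyclotomicZp.zpExtension 2).restrict K h).layer (b + k)) ↥(((CyclotomicZp.zpExtension 2).restrict K h).layer (b + k + 1)) c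
  refine ⟨fun 𝔓b h2b c hc => ?_, fun 𝔓 h2 hmem => ?_⟩
  · have hc' : classGroupExtend ↥(((CyclotomicZp.zpExtension 2).restrict K h).layer (b + k)) ↥(((CyclotomicZp.zpExtension 2).restrict K h).layer (b + k + 1))
        (classGroupExtend ↥(((CyclotomicZp.zpExtension 2).restrict K h).layer b) ↥(((CyclotomicZp.zpExtension 2).restrict K h).layer (b + k)) c) = 1 := by
      rw [hcomp]; exact hc
    rcases hker1 𝔓k h2k _ hc' with h1 | h1
    · exact hkerk 𝔓b h2b c h1
    · exact absurd ⟨c, h1⟩ (hnotk 𝔓k h2k)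
  · obtain ⟨c, hc⟩ := hmem
    exact hnot1 𝔓 h2 ⟨classGroupExtend ↥(((CyclotomicZp.zpExtension 2).restrict K h).layer b) ↥(((CyclotomicZp.zpExtension 2).restrict K h).layer (b + k)) c, by rw [hcomp]; exact hc⟩

/-- ★ **The multi-step capitulation kernel and the non-extended dyadic class.**  `K ∋ √−d`, `d ≡ 1 (mod 4)` squarefree, `d ≠ 1`, `κ₀ = (ℚ_∞)|_K`,
`b ≥ 1`, `k ≥ 1`: (i) every class of `K_b` that capitulates in `K_{b+k}` is `1` or `[𝔓_b]`; (ii) `[𝔓_{b+k}]` is not the extension of a class of `K_b`.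
(Induction on `k` from `dyadicCapitulation_layer_restrict`.) [cite: Ferrero1980AJM, §3] [cite: Kida1979Tohoku, Thm. 1] -/
theorem dyadicKernel_layer_restrict (hK2 : Module.finrank ℚ K = 2) {d : ℕ} (hsf : Squarefree d) (hd4 : d % 4 = 1) (hd1 : d ≠ 1)
    (hη : ∃ η : K, η ^ 2 = -((d : ℕ) : K))
    (h : Function.Surjective ((CyclotomicZp.zpExtension 2).toContinuousMonoidHom.comp (absGaloisRestrict ℚ K))) (b : ℕ) (hb : 1 ≤ b) (k : ℕ) (hk : 1 ≤ k) :
    haveI : FiniteDimensional K ↥(((CyclotomicZp.zpExtension 2).restrict K h).layer b) := ((CyclotomicZp.zpExtension 2).restrict K h).finiteDimensional_layer_holds b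
    haveI : FiniteDimensional K ↥(((CyclotomicZp.zpExtension 2).restrict K h).layer (b + k)) := ((CyclotomicZp.zpExtension 2).restrict K h).finiteDimensional_layer_holds (b + k)
    haveI : NumberField ↥(((CyclotomicZp.zpExtension 2).restrict K h).layer b) := NumberField.of_module_finite K _
    haveI : NumberField ↥(((CyclotomicZp.zpExtension 2).restrict K h).layer (b + k)) := NumberField.of_module_finite K _
    (∀ 𝔓b : HeightOneSpectrum (𝓞 ↥(((CyclotomicZp.zpExtension 2).restrict K h).layer b)), (2 : 𝓞 ↥(((CyclotomicZp.zpExtension 2).restrict K h).layer b)) ∈ 𝔓b.asIdeal →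
        ∀ c, @classGroupExtend ↥(((CyclotomicZp.zpExtension 2).restrict K h).layer b) ↥(((CyclotomicZp.zpExtension 2).restrict K h).layer (b + k)) _ _ _ _
            (IntermediateField.inclusion (((CyclotomicZp.zpExtension 2).restrict K h).layer_mono (Nat.le_add_right b k))).toRingHom.toAlgebra c = 1 →
          c = 1 ∨ c = ClassGroup.mk0 ⟨𝔓b.asIdeal, mem_nonZeroDivisors_of_ne_zero 𝔓b.ne_bot⟩) ∧
      (∀ 𝔓 : HeightOneSpectrum (𝓞 ↥(((CyclotomicZp.zpExtension 2).restrict K h).layer (b + k))), (2 : 𝓞 ↥(((CyclotomicZp.zpExtension 2).restrict K h).layer (b + k))) ∈ 𝔓.asIdeal →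
        ClassGroup.mk0 ⟨𝔓.asIdeal, mem_nonZeroDivisors_of_ne_zero 𝔓.ne_bot⟩ ∉
          (@classGroupExtend ↥(((CyclotomicZp.zpExtension 2).restrict K h).layer b) ↥(((CyclotomicZp.zpExtension 2).restrict K h).layer (b + k)) _ _ _ _
            (IntermediateField.inclusion (((CyclotomicZp.zpExtension 2).restrict K h).layer_mono (Nat.le_add_right b k))).toRingHom.toAlgebra).range) := by
  induction k with
  | zero => exact absurd hk (by omega)
  | succ k ihk =>
    haveI : FiniteDimensional K ↥(((CyclotomicZp.zpExtension 2).restrict K h).layer b) := ((CyclotomicZp.zpExtension 2).restrict K h).finiteDimensional_layer_holds b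
    haveI : FiniteDimensional K ↥(((CyclotomicZp.zpExtension 2).restrict K h).layer (b + k)) := ((CyclotomicZp.zpExtension 2).restrict K h).finiteDimensional_layer_holds (b + k)
    haveI : FiniteDimensional K ↥(((CyclotomicZp.zpExtension 2).restrict K h).layer (b + k + 1)) := ((CyclotomicZp.zpExtension 2).restrict K h).finiteDimensional_layer_holds (b + k + 1)
    haveI : NumberField ↥(((CyclotomicZp.zpExtension 2).restrict K h).layer b) := NumberField.of_module_finite K _
    haveI : NumberField ↥(((CyclotomicZp.zpExtension 2).restrict K h).layer (b + k)) := NumberField.of_module_finite K _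
    haveI : NumberField ↥(((CyclotomicZp.zpExtension 2).restrict K h).layer (b + k + 1)) := NumberField.of_module_finite K _
    rcases Nat.eq_zero_or_pos k with hk0 | hkpos
    · subst hk0
      have h1 := dyadicCapitulation_layer_restrict K hK2 hsf hd4 hd1 hη h b hb
      exact h1
    · have result : (∀ 𝔓b : HeightOneSpectrum (𝓞 ↥(((CyclotomicZp.zpExtension 2).restrict K h).layer b)), (2 : 𝓞 ↥(((CyclotomicZp.zpExtension 2).restrict K h).layer b)) ∈ 𝔓b.asIdeal →
        ∀ c, @classGroupExtend ↥(((CyclotomicZp.zpExtension 2).restrict K h).layer b) ↥(((CyclotomicZp.zpExtension 2).restrict K h).layer (b + k + 1)) _ _ _ _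
            (IntermediateField.inclusion (((CyclotomicZp.zpExtension 2).restrict K h).layer_mono (by omega))).toRingHom.toAlgebra c = 1 →
          c = 1 ∨ c = ClassGroup.mk0 ⟨𝔓b.asIdeal, mem_nonZeroDivisors_of_ne_zero 𝔓b.ne_bot⟩) ∧
      (∀ 𝔓 : HeightOneSpectrum (𝓞 ↥(((CyclotomicZp.zpExtension 2).restrict K h).layer (b + k + 1))), (2 : 𝓞 ↥(((CyclotomicZp.zpExtension 2).restrict K h).layer (b + k + 1))) ∈ 𝔓.asIdeal →
        ClassGroup.mk0 ⟨𝔓.asIdeal, mem_nonZeroDivisors_of_ne_zero 𝔓.ne_bot⟩ ∉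
          (@classGroupExtend ↥(((CyclotomicZp.zpExtension 2).restrict K h).layer b) ↥(((CyclotomicZp.zpExtension 2).restrict K h).layer (b + k + 1)) _ _ _ _
            (IntermediateField.inclusion (((CyclotomicZp.zpExtension 2).restrict K h).layer_mono (by omega))).toRingHom.toAlgebra).range) :=
        dyadicKernel_step K hK2 hsf hd4 hd1 hη h b k (by omega) (ihk hkpos)
      exact result

/-! ## §2 The dyadic class is not a square -/

/-- ★ **`[𝔓_{b+k}] ∉ Cl(K_{b+k})²`** for `b ≥ 2`, `k ≥ 2` and `2·rank₂ Cl(K_{b+k}) ≤ 2^k − 1` (`K ∋ √−d`, `d ≡ 1 (mod 4)` squarefree, `d ≠ 1`, `κ₀ = (ℚ_∞)|_K`):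
if `[𝔓_{b+k}] = x²` then `x⁴ = 1`, `σ(x²) = x²`, so `i(N_{K_{b+k}/K_b} x) = 1` (tree `classGroupExtend_classGroupNorm_eq_one_of_pow_sq_eq_one`), hence
`N x ∈ {1, [𝔓_b]}` (§1) and `(N x)² = 1`; but `(N x)² = N[𝔓_{b+k}] = [𝔓_b] ≠ 1`. [cite: Ferrero1980AJM, §3] [cite: Kida1979Tohoku, Thm. 1]
[cite: Washington1997, §13.3 Prop. 13.22] -/
theorem mk0_dyadic_not_mem_range_pow_two_layer_restrict (hK2 : Module.finrank ℚ K = 2) {d : ℕ} (hsf : Squarefree d) (hd4 : d % 4 = 1) (hd1 : d ≠ 1)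
    (hη : ∃ η : K, η ^ 2 = -((d : ℕ) : K))
    (h : Function.Surjective ((CyclotomicZp.zpExtension 2).toContinuousMonoidHom.comp (absGaloisRestrict ℚ K))) (b k : ℕ) (hb : 2 ≤ b) (hk : 2 ≤ k)
    (hrk : 2 * classGroupPRank ((CyclotomicZp.zpExtension 2).restrict K h) (b + k) ≤ 2 ^ k - 1) [NumberField ↥(((CyclotomicZp.zpExtension 2).restrict K h).layer (b + k))] :
    ∀ 𝔓 : HeightOneSpectrum (𝓞 ↥(((CyclotomicZp.zpExtension 2).restrict K h).layer (b + k))), (2 : 𝓞 ↥(((CyclotomicZp.zpExtension 2).restrict K h).layer (b + k))) ∈ 𝔓.asIdeal →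
      ClassGroup.mk0 ⟨𝔓.asIdeal, mem_nonZeroDivisors_of_ne_zero 𝔓.ne_bot⟩ ∉
        (powMonoidHom 2 : ClassGroup (𝓞 ↥(((CyclotomicZp.zpExtension 2).restrict K h).layer (b + k))) →* ClassGroup (𝓞 ↥(((CyclotomicZp.zpExtension 2).restrict K h).layer (b + k)))).range := by
  classical
  intro 𝔓 h2 hmem
  obtain ⟨x, hx⟩ := hmem
  rw [powMonoidHom_apply] at hx
  haveI : FiniteDimensional K ↥(((CyclotomicZp.zpExtension 2).restrict K h).layer b) := ((CyclotomicZp.zpExtension 2).restrict K h).finiteDimensional_layer_holds b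
  haveI : FiniteDimensional K ↥(((CyclotomicZp.zpExtension 2).restrict K h).layer (b + k)) := ((CyclotomicZp.zpExtension 2).restrict K h).finiteDimensional_layer_holds (b + k)
  haveI : NumberField ↥(((CyclotomicZp.zpExtension 2).restrict K h).layer b) := NumberField.of_module_finite K _
  letI : Algebra ↥(((CyclotomicZp.zpExtension 2).restrict K h).layer b) ↥(((CyclotomicZp.zpExtension 2).restrict K h).layer (b + k)) :=
    (IntermediateField.inclusion (((CyclotomicZp.zpExtension 2).restrict K h).layer_mono (Nat.le_add_right b k))).toRingHom.toAlgebra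
  haveI : IsScalarTower K ↥(((CyclotomicZp.zpExtension 2).restrict K h).layer b) ↥(((CyclotomicZp.zpExtension 2).restrict K h).layer (b + k)) :=
    IsScalarTower.of_algebraMap_eq fun x => ((IntermediateField.inclusion (((CyclotomicZp.zpExtension 2).restrict K h).layer_mono (Nat.le_add_right b k))).commutes x).symm
  haveI : FiniteDimensional ↥(((CyclotomicZp.zpExtension 2).restrict K h).layer b) ↥(((CyclotomicZp.zpExtension 2).restrict K h).layer (b + k)) := Module.Finite.of_restrictScalars_finite K _ _
  haveI : IsGalois K ↥(((CyclotomicZp.zpExtension 2).restrict K h).layer (b + k)) := ((CyclotomicZp.zpExtension 2).restrict K h).isGalois_layer_holds _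
  haveI : IsGalois ↥(((CyclotomicZp.zpExtension 2).restrict K h).layer b) ↥(((CyclotomicZp.zpExtension 2).restrict K h).layer (b + k)) := isGalois_layer_layer ((CyclotomicZp.zpExtension 2).restrict K h)
  haveI : IsCyclic (↥(((CyclotomicZp.zpExtension 2).restrict K h).layer (b + k)) ≃ₐ[↥(((CyclotomicZp.zpExtension 2).restrict K h).layer b)] ↥(((CyclotomicZp.zpExtension 2).restrict K h).layer (b + k))) := isCyclic_aut_layer_layer' ((CyclotomicZp.zpExtension 2).restrict K h)
  obtain ⟨σ, hσ⟩ := IsCyclic.exists_generator (α := ↥(((CyclotomicZp.zpExtension 2).restrict K h).layer (b + k)) ≃ₐ[↥(((CyclotomicZp.zpExtension 2).restrict K h).layer b)] ↥(((CyclotomicZp.zpExtension 2).restrict K h).layer (b + k)))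
  have hcard : Nat.card (↥(((CyclotomicZp.zpExtension 2).restrict K h).layer (b + k)) ≃ₐ[↥(((CyclotomicZp.zpExtension 2).restrict K h).layer b)] ↥(((CyclotomicZp.zpExtension 2).restrict K h).layer (b + k))) = 2 ^ k := by
    rw [card_aut_layer_layer ((CyclotomicZp.zpExtension 2).restrict K h) (Nat.le_add_right b k), Nat.add_sub_cancel_left]
  have hr := natCard_torsion_classGroup_layer_eq ((CyclotomicZp.zpExtension 2).restrict K h) (b + k)
  obtain ⟨𝔓', h2', -, huniq⟩ := exists_unique_dyadic_layer_restrict K hK2 hd4 hη h (b + k)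
  obtain rfl := huniq 𝔓 h2
  have hsq := mk0_dyadic_sq_eq_one_layer_restrict K hK2 hd4 hη h (b + k) 𝔓 h2
  have hfix : ClassGroup.mulEquiv (AmbiguousClass.intAut σ) (x ^ 2) = x ^ 2 := by
    rw [hx]; exact mulEquiv_intAut_mk0_eq_of_unique σ 𝔓 h2 huniq
  have hx4 : x ^ (2 ^ 2) = 1 := by
    rw [show (2 : ℕ) ^ 2 = 2 * 2 by norm_num, pow_mul, hx, hsq]
  have hjN := classGroupExtend_classGroupNorm_eq_one_of_pow_sq_eq_one ↥(((CyclotomicZp.zpExtension 2).restrict K h).layer b) ↥(((CyclotomicZp.zpExtension 2).restrict K h).layer (b + k)) 2 k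
    (classGroupPRank ((CyclotomicZp.zpExtension 2).restrict K h) (b + k)) hk σ hσ hcard hr hrk x hfix hx4
  obtain ⟨𝔓b, h2b, -, -⟩ := exists_unique_dyadic_layer_restrict K hK2 hd4 hη h b
  have hN := classGroupNorm_mk0_dyadic_layer_restrict K hK2 hd4 hη h b k 𝔓b h2b 𝔓 h2
  have hq2 : classGroupNorm ↥(((CyclotomicZp.zpExtension 2).restrict K h).layer b) ↥(((CyclotomicZp.zpExtension 2).restrict K h).layer (b + k)) x ^ 2 =
      ClassGroup.mk0 ⟨𝔓b.asIdeal, mem_nonZeroDivisors_of_ne_zero 𝔓b.ne_bot⟩ := by rw [← map_pow, hx, hN]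
  obtain ⟨hker, -⟩ := dyadicKernel_layer_restrict K hK2 hsf hd4 hd1 hη h b (by omega) k (by omega)
  have hcb := mk0_dyadic_ne_one_layer_restrict K hK2 hsf hd4 hd1 hη h b hb 𝔓b h2b
  have hsqb := mk0_dyadic_sq_eq_one_layer_restrict K hK2 hd4 hη h b 𝔓b h2b
  rcases hker 𝔓b h2b (classGroupNorm ↥(((CyclotomicZp.zpExtension 2).restrict K h).layer b) ↥(((CyclotomicZp.zpExtension 2).restrict K h).layer (b + k)) x) hjN with h1 | h1
  · rw [h1, one_pow] at hq2; exact hcb hq2.symm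
  · rw [h1, hsqb] at hq2; exact hcb hq2.symm

/-! ## §3 For all large layers -/

/-- ★ **Ferrero's dyadic class is eventually not a square: `∃ m₁ ∀ m ≥ m₁`, `[𝔓_m] ∉ Cl(K_m)²`** (`K ∋ √−d`, `d ≡ 1 (mod 4)` squarefree, `d ≠ 1`,
`κ₀ = (ℚ_∞)|_K`; the `2`-ranks along the tower are bounded by `S = Σ_{ℓ ∣ d} 2^{ord₂(ℓ²−1)−3}`, tree `classGroupPRank_cyclotomic_two_eq_sum_of_sq_eq_neg`, and
§2 applies with `k = 2S + 2`, `m ≥ k + 2`).  Equivalently `ℤ/2·c_m` is a direct summand-obstruction: `#(A_m/(2A_m + ⟨c_m⟩)) = 2^{rank − 1}`.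
[cite: Ferrero1980AJM, §3] [cite: Kida1979Tohoku, Thm. 1] -/
theorem exists_forall_mk0_dyadic_not_mem_range_pow_two (hK2 : Module.finrank ℚ K = 2) {d : ℕ} (hsf : Squarefree d) (hd4 : d % 4 = 1) (hd1 : d ≠ 1)
    (hη : ∃ η : K, η ^ 2 = -((d : ℕ) : K))
    (h : Function.Surjective ((CyclotomicZp.zpExtension 2).toContinuousMonoidHom.comp (absGaloisRestrict ℚ K))) :
    ∃ m₁ : ℕ, ∀ m, m₁ ≤ m →
      haveI : FiniteDimensional K ↥(((CyclotomicZp.zpExtension 2).restrict K h).layer m) := ((CyclotomicZp.zpExtension 2).restrict K h).finiteDimensional_layer_holds m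
      haveI : NumberField ↥(((CyclotomicZp.zpExtension 2).restrict K h).layer m) := NumberField.of_module_finite K _
      ∀ 𝔓 : HeightOneSpectrum (𝓞 ↥(((CyclotomicZp.zpExtension 2).restrict K h).layer m)), (2 : 𝓞 ↥(((CyclotomicZp.zpExtension 2).restrict K h).layer m)) ∈ 𝔓.asIdeal →
        ClassGroup.mk0 ⟨𝔓.asIdeal, mem_nonZeroDivisors_of_ne_zero 𝔓.ne_bot⟩ ∉
          (powMonoidHom 2 : ClassGroup (𝓞 ↥(((CyclotomicZp.zpExtension 2).restrict K h).layer m)) →* ClassGroup (𝓞 ↥(((CyclotomicZp.zpExtension 2).restrict K h).layer m))).range := by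
  haveI : Fact (Nat.Prime 2) := ⟨Nat.prime_two⟩
  have hcyc : (CyclotomicZp.zpExtension 2).IsCyclotomic := CyclotomicZp.isCyclotomic_zpExtension 2
  have hκ₀c : ((CyclotomicZp.zpExtension 2).restrict K h).IsCyclotomic := isCyclotomic_restrict (CyclotomicZp.zpExtension 2) hcyc K h
  set S : ℕ := ∑ ℓ ∈ d.primeFactors, 2 ^ (padicValNat 2 (ℓ ^ 2 - 1) - 3) with hS
  have hrank : ∀ m, classGroupPRank ((CyclotomicZp.zpExtension 2).restrict K h) m ≤ S := fun m => by
    rw [classGroupPRank_cyclotomic_two_eq_sum_of_sq_eq_neg K hK2 hsf hd4 hη ((CyclotomicZp.zpExtension 2).restrict K h) hκ₀c m, hS]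
    exact Finset.sum_le_sum fun ℓ _ => Nat.pow_le_pow_right (by norm_num) (min_le_right _ _)
  refine ⟨2 * S + 2 + 2, fun m hm => ?_⟩
  obtain ⟨b, rfl⟩ : ∃ b, m = b + (2 * S + 2) := ⟨m - (2 * S + 2), by omega⟩
  intro 𝔓 h2
  haveI : FiniteDimensional K ↥(((CyclotomicZp.zpExtension 2).restrict K h).layer (b + (2 * S + 2))) := ((CyclotomicZp.zpExtension 2).restrict K h).finiteDimensional_layer_holds _
  haveI : NumberField ↥(((CyclotomicZp.zpExtension 2).restrict K h).layer (b + (2 * S + 2))) := NumberField.of_module_finite K _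
  have hpow : 2 * S + 2 < 2 ^ (2 * S + 2) := Nat.lt_two_pow_self
  exact mk0_dyadic_not_mem_range_pow_two_layer_restrict K hK2 hsf hd4 hd1 hη h b (2 * S + 2) (by omega) (by omega)
    (by have := hrank (b + (2 * S + 2)); omega) 𝔓 h2

end Literature.NumberTheory.IwasawaTheory

end
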